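import Summits.NavierStokesRegularity.NavierStokesRegularity.Theses.ScaledTopAlignment
import HarnessLib

/-!
# Route `ScaledTopAlignment`: the deciding crux W3ᵐᵗ (stmt-NavierStokesRegularity-19551) IMPLIES the banked
# NEAR-MAXIMUM most-times door W3ⁿᵐ, BY NAME (dominance edge; referee ref2 SCORE-p5-6 remark)

W3ⁿᵐ (planner p3's banked rev-16 candidate; body = HOME/ns-regularity-ideate-p5/W3nm.signature.txt = the
hypothesis of `navierStokesRegularity_of_nearMaxMostTimesBulkAlignment_of_noTypeII`) is W3ᵐᵗ with one more
premise in the window clause (relative near-maximality `q|ω(t,x′)| ≤ |ω(t,x)|`), so W3ᵐᵗ implies it by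
dropping the premise (`nearMaxMostTimesBulkAlignment_of_aprioriMostTimesBulkAlignment`; stated with the body
spelled out since the item is not filed). (The composed certificate W3ᵐᵗ → NoTypeII → Clay (A) through a weaker
door is already `navierStokesRegularity_of_aprioriMostTimesBulkAlignment_via_seq`.)
WHAT THIS IS NOT: not NS regularity; implications between OPEN statements. [folklore]
-/

noncomputable section
-- the summit and its single sub-problem share the name (CONVENTIONS §1), as in every Theorems file
set_option linter.dupNamespace false
open MeasureTheory Set Filter Topology
open Literature.Analysis Literature.Analysis.FluidPDE

namespace Summit.NavierStokesRegularity.NavierStokesRegularity.Theorems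

/-- **W3ᵐᵗ ⇒ W3ⁿᵐ, BY NAME** (stmt-19551 ⇒ the near-maximum most-times door: the relative near-maximum
premise is dropped). [folklore] -/
theorem nearMaxMostTimesBulkAlignment_of_aprioriMostTimesBulkAlignment
    (hW : Summit.NavierStokesRegularity.NavierStokesRegularity.Theses.ScaledTopAlignment.AprioriMostTimesBulkAlignment) :
    ∀ (ν T : ℝ), 0 < ν → 0 < T → ∀ (u : ℝ → EuclideanSpace ℝ (Fin 3) → EuclideanSpace ℝ (Fin 3)) (p : ℝ → EuclideanSpace ℝ (Fin 3) → ℝ), Literature.Analysis.FluidPDE.IsClassicalNSSolutionOn (Set.Ico 0 T) ν 0 u p → Literature.Analysis.FluidPDE.IsLerayHopfOn T ν 0 (u 0) u → Literature.Analysis.FluidPDE.HasRapidSpatialDecay (u 0) → ∃ lam0 : ℝ, lam0 < 1 ∧ ∃ R0 : ℝ, 0 < R0 ∧ ∃ θ : ℝ, θ < 1 ∧ ∀ κ : ℝ, 0 < κ → ∀ q : ℝ, 0 < q → ∀ ε : ℝ, 0 < ε → ∀ δ : ℝ, 0 < δ → ∃ M : ℝ, 0 < M ∧ ∃ E : Set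 ℝ, (∃ h0 : ℝ, 0 < h0 ∧ ∀ h : ℝ, 0 < h → h < h0 → MeasureTheory.volume (E ∩ Set.Ioo (T - h) T) ≤ ENNReal.ofReal (θ * h)) ∧ ∀ t ∈ Set.Ico 0 T, t ∉ E → ∀ x : EuclideanSpace ℝ (Fin 3), M ≤ ‖Literature.Analysis.FluidPDE.curl (u t) x‖ → κ / (T - t) ≤ ‖Literature.Analysis.FluidPDE.curl (u t) x‖ → (∀ x' : EuclideanSpace ℝ (Fin 3), q * ‖Literature.Analysis.FluidPDE.curl (u t) x'‖ ≤ ‖Literature.Analysis.FluidPDE.curl (u t) x‖) → MeasureTheory.volume {y : EuclideanSpace ℝ (Fin 3) | lam0 * ‖Literature.Analysis.FluidPDE.curl (u t) x‖ ≤ ‖Literature.Analysis.FluidPDE.curl (u t) y‖ ∧ ‖x - y‖ ≤ R0 * Real.sqrt (ν / ‖Literature.Analysis.FluidPDE.curl (u t) x‖) ∧ ε < Real.sqrt (1 - (inner ℝ (‖Literature.Analysis.FluidPDE.curl (u t) x‖⁻¹ • Literature.Analysis.FluidPDE.curl (u t) x) (‖Literature.Analysis.FluidPDE.curl (u t) y‖⁻¹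 • Literature.Analysis.FluidPDE.curl (u t) y)) ^ 2)} ≤ ENNReal.ofReal (δ * Real.sqrt (ν / ‖Literature.Analysis.FluidPDE.curl (u t) x‖) ^ 3) := by
  intro ν T hν hT u p hcl hLH hdec
  obtain ⟨lam0, hlam0, R0, hR0, θ, hθ, hmain⟩ := hW ν T hν hT u p hcl hLH hdec
  refine ⟨lam0, hlam0, R0, hR0, θ, hθ, fun κ hκ q _hq ε hε δ hδ => ?_⟩
  obtain ⟨M, hM, E, hE, hwin⟩ := hmain κ hκ ε hε δ hδ
  exact ⟨M, hM, E, hE, fun t ht htE x hx hrate _ => hwin t ht htE x hx hrate⟩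

end Summit.NavierStokesRegularity.NavierStokesRegularity.Theorems

end
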